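import Summits.ValiantsHypothesis.Statement
import Literature.Computability.AlgebraicComplexity.GCTObstructions
import Literature.Computability.AlgebraicComplexity.GCT
import Literature.Computability.AlgebraicComplexity.OrbitClosure
import Literature.Computability.AlgebraicComplexity.OrbitCoordinateRing
import Literature.Computability.AlgebraicComplexity.DeterminantalComplexity
import Literature.Computability.AlgebraicComplexity.PermanentVsDeterminant
import Literature.Computability.AlgebraicComplexity.CircuitDepth
import Literature.Computability.AlgebraicComplexity.VPDeterminantalQP
import Literature.Computability.AlgebraicComplexity.EquivariantDC
import Literature.Computability.AlgebraicComplexity.LandsbergRessayre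
import Literature.Computability.AlgebraicComplexity.BIPNoOccurrence
import Literature.Computability.AlgebraicComplexity.ValiantBooleanBridge
import Mathlib

/-!
# ValiantsHypothesis / GCTMult — obstruction principle (crux #3)

Route `ValiantsHypothesis/GCTMult`, item `stmt-ValiantsHypothesis-0326`: if `g ∈ Δ[f]` then
`I(GL · f)_m ≤ I(GL · g)_m` (Bürgisser–Landsberg–Manivel–Weyman 2011 §2; Mulmuley–Sohoni 2001
§4). This is exactly the in-tree Literature theorem
`Literature.Computability.AlgebraicComplexity.orbitVanishingIdeal_le_of_mem_orbitClosure` (file `GCTObstructions.lean`),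
specialised to `k = ℂ`; recorded here so the route item closes.

(`import Mathlib` + the topic's Literature files: sibling signatures of the route are elaborated by
the gate in this file's context.)
-/

namespace Literature.CplxAlg

/-- Settles `stmt-ValiantsHypothesis-0326` (crux #3 of route GCTMult, obstruction principle):
`g ∈ Δ[f] ⇒ orbitVanishingIdeal f m ≤ orbitVanishingIdeal g m` over `ℂ`; immediate from
`orbitVanishingIdeal_le_of_mem_orbitClosure` (found by `exact?`). [folklore] -/
theorem gct_obstruction_principle :
    ∀ {σ : Type} [Fintype σ] [DecidableEq σ] (f g : MvPolynomial σ ℂ) (m : ℕ),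
      g ∈ Literature.Computability.AlgebraicComplexity.orbitClosure f →
        Literature.Computability.AlgebraicComplexity.orbitVanishingIdeal f m ≤ Literature.Computability.AlgebraicComplexity.orbitVanishingIdeal g m :=
  fun _ _ _ h => Literature.Computability.AlgebraicComplexity.orbitVanishingIdeal_le_of_mem_orbitClosure h

end Literature.CplxAlg
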